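import Literature.Computability.Cryptography.WordRAM
import HarnessLib

/-!
# The word RAM — write counting (a `t`-step run changes at most `t` cells)

The frame lemma behind every "an algorithm must at least write its output" lower bound for the
concrete word RAM of `Literature.Computability.Cryptography.WordRAM`, run under the trivial oracle
`noOracle` (the setting of the running-time predicates `FGProblem.InTime…`):

* `Operand.exists_write_apply_eq`: writing through an operand changes at most one cell;
* `exists_mem_eq_of_step`: one step changes at most one memory cell (`op`, `rand` write through one
  operand; `jmp`, `jz`, `halt` write nothing; a `query` answered by `noOracle` writes the single
  length word `0` — with a genuine oracle it would write a whole answer segment, and no such bound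
  holds);
* `exists_finset_mem_eq_of_iterate_step`, `HaltsWithin.exists_finset_mem_eq`: along `n` steps, resp.
  in the halting configuration of a run of at most `t` steps, all cells outside a set of at most `n`
  (resp. `t`) addresses keep their initial contents;
* `HaltsWithin.card_le_of_mem_ne`: hence any set of addresses whose contents differ from the
  initial memory at the end of a `≤ t`-step run has at most `t` elements;
* `getElem_readOut`: the output convention read back cell by cell
  (`(readOut mem)[p] = mem (1 + p)`).

Companion of `…WordRAMBounds` (value/address bounds of oracle-free runs), same proof pattern (case
analysis of `step`, induction along `(flip bind step)^[n]`).

## References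

* T. Hagerup, *Sorting and searching on the word RAM*, STACS 1998, §2 (one instruction writes one
  word).
* Output-size (`Ω(output length)`) time lower bounds: folklore.
-/

namespace Literature.Computability.Cryptography.WordRAM

open StateTransition

/-! ## One step -/

/-- Writing through an operand changes at most one cell (`imm`: none, `dir a`: cell `a`,
`ind a`: cell `mem a`). [folklore] -/
theorem Operand.exists_write_apply_eq (mem : ℕ → ℕ) (v : ℕ) (dst : Operand) :
    ∃ a : ℕ, ∀ b, b ≠ a → dst.write mem v b = mem b := by
  cases dst with
  | imm c => exact ⟨0, fun b _ => rfl⟩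
  | dir a => exact ⟨a, fun b hb => show Function.update mem a v b = mem b from
      Function.update_of_ne hb v mem⟩
  | ind a => exact ⟨mem a, fun b hb => show Function.update mem (mem a) v b = mem b from
      Function.update_of_ne hb v mem⟩

/-- **One step changes at most one cell** (under the trivial oracle `noOracle`). [folklore] -/
theorem exists_mem_eq_of_step {P : Program} {w : ℕ} {ρ : ℕ → ℕ} {c c' : Cfg}
    (hs : step P w noOracle ρ c = some c') :
    ∃ a : ℕ, ∀ b, b ≠ a → c'.mem b = c.mem b := by
  unfold step at hs
  cases hpc : c.pc with
  | none => simp [hpc] at hs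
  | some i =>
    simp only [hpc] at hs
    cases hI : P[i]? with
    | none => simp only [hI, Option.some.injEq] at hs; subst hs; exact ⟨0, fun b _ => rfl⟩
    | some I =>
      simp only [hI] at hs
      cases I with
      | halt => simp only [Option.some.injEq] at hs; subst hs; exact ⟨0, fun b _ => rfl⟩
      | jmp t => simp only [Option.some.injEq] at hs; subst hs; exact ⟨0, fun b _ => rfl⟩
      | jz x t => simp only [Option.some.injEq] at hs; subst hs; exact ⟨0, fun b _ => rfl⟩
      | op o dst x y =>
        simp only [Option.some.injEq] at hs; subst hs
        exact Operand.exists_write_apply_eq _ _ dst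
      | rand dst =>
        simp only [Option.some.injEq] at hs; subst hs
        exact Operand.exists_write_apply_eq _ _ dst
      | query qa ql aa =>
        simp only [noOracle_apply, List.map_nil, List.length_nil, Option.some.injEq] at hs
        subst hs
        simp only [writeSeg_nil]
        exact ⟨aa.read c.mem, fun b hb => Function.update_of_ne hb _ _⟩

/-! ## Whole runs -/

/-- **`n` steps change at most `n` cells**: along `n` steps under the trivial oracle, all cells
outside some set of at most `n` addresses keep their contents. [folklore] -/
theorem exists_finset_mem_eq_of_iterate_step {P : Program} {w : ℕ} {ρ : ℕ → ℕ} :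
    ∀ (n : ℕ) {c c' : Cfg}, (flip bind (step P w noOracle ρ))^[n] (some c) = some c' →
      ∃ S : Finset ℕ, S.card ≤ n ∧ ∀ b ∉ S, c'.mem b = c.mem b
  | 0, c, c', h => by
      simp only [Function.iterate_zero, id_eq, Option.some.injEq] at h
      subst h
      exact ⟨∅, le_rfl, fun b _ => rfl⟩
  | n + 1, c, c', h => by
      rw [Function.iterate_succ_apply] at h
      change (flip bind (step P w noOracle ρ))^[n] (step P w noOracle ρ c) = some c' at h
      cases hs : step P w noOracle ρ c with
      | none =>
        rw [hs] at h
        have : (flip bind (step P w noOracle ρ))^[n] (none : Option Cfg) = none :=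
          Function.iterate_fixed rfl n
        rw [this] at h
        exact absurd h (by simp)
      | some d =>
        rw [hs] at h
        obtain ⟨S, hS, hmem⟩ := exists_finset_mem_eq_of_iterate_step n h
        obtain ⟨a, ha⟩ := exists_mem_eq_of_step hs
        refine ⟨insert a S, (Finset.card_insert_le _ _).trans (by omega), fun b hb => ?_⟩
        rw [Finset.mem_insert, not_or] at hb
        rw [hmem b hb.2, ha b hb.1]

/-- **A `t`-step run changes at most `t` cells**: in the halting configuration of a run of at most
`t` steps under the trivial oracle, all cells outside some set of at most `t` addresses still hold
their initial contents. [folklore] -/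
theorem HaltsWithin.exists_finset_mem_eq {P : Program} {w : ℕ} {ρ : ℕ → ℕ} {x : List ℕ}
    {t : ℕ} {c : Cfg} (h : HaltsWithin P w noOracle ρ x t c) :
    ∃ S : Finset ℕ, S.card ≤ t ∧ ∀ b ∉ S, c.mem b = (init w x).mem b := by
  obtain ⟨⟨e⟩, -⟩ := h
  obtain ⟨S, hS, hmem⟩ := exists_finset_mem_eq_of_iterate_step e.steps e.evals_in_steps
  exact ⟨S, hS.trans e.steps_le_m, hmem⟩

/-- **Write counting.** Any set of addresses whose contents at the end of a run of at most `t`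
steps (trivial oracle) differ from the initial memory has at most `t` elements. [folklore] -/
theorem HaltsWithin.card_le_of_mem_ne {P : Program} {w : ℕ} {ρ : ℕ → ℕ} {x : List ℕ}
    {t : ℕ} {c : Cfg} (h : HaltsWithin P w noOracle ρ x t c) {T : Finset ℕ}
    (hT : ∀ b ∈ T, c.mem b ≠ (init w x).mem b) : T.card ≤ t := by
  obtain ⟨S, hS, hmem⟩ := h.exists_finset_mem_eq
  refine le_trans (Finset.card_le_card fun b hb => ?_) hS
  by_contra hbS
  exact hT b hb (hmem b hbS)

/-- The output convention read back cell by cell: word `p` of `readOut mem` is `mem (1 + p)`.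
[folklore] -/
theorem getElem_readOut (mem : ℕ → ℕ) {p : ℕ} (hp : p < (readOut mem).length) :
    (readOut mem)[p] = mem (1 + p) := by
  simp [readOut, readSeg]

end Literature.Computability.Cryptography.WordRAM
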